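import Summits.HodgeConjecture.CorCM.GaloisTwentyFourDegenerateModels
import Summits.HodgeConjecture.CorCM.GaloisSemidihedralModularNormalForms
import HarnessLib

/-!
# Semidihedral and modular Galois groups of every order `4h` (`h ≥ 4` even): the DOUBLE INTERVAL is a primitive
# degenerate CM type — simple degenerate CM abelian varieties of dimension `2h`

COR-CM (cell `pub-hodgecm2`), binder seat b04 (gen 22), count-neutral claim GALOIS-DIHEDRAL, part VIII.  KERNEL ONLY:
theorems; no definition, no named fact, no `sorry`.  `HC_CM` is neither used nor claimed.

SETTING (inside `G = Gal(K/ℚ)` itself; no model type is needed).  `α, ξ ∈ G` with `ord α = 2h`, `ξ ∉ ⟨α⟩`, `ξ² = 1`,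
`|G| = 4h` and the relation `ξ α = α^{u₀} ξ` with `u₀ = h − 1` (SEMIDIHEDRAL type, `SD_{4h}` for `h = 2^{k−2}`) or
`u₀ = h + 1` (MODULAR type, `M_{4h}`); complex conjugation is `c = α^h`.  For `h` even, `u = u₀` is a unit of `ℤ/2h`
with `u² = 1`, `u·h = h`, so `j ↦ u j` is a bijection of `ℤ/2h` fixing `0` and `h` (part VIII-a `CorCM/GaloisSemidihedralModularNormalForms`, with the normal forms `αⁱ`, `αⁱξ`).  THE DOUBLE INTERVAL
`T₀ = {αⁱ : 0 ≤ i < h} ⊔ {αⁱ ξ : 0 ≤ i < h}` is then (§3):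
* a CM set for `c = α^h`;
* BALANCED against the four-element set `D = {1, α^{h−1}, α^h ξ, α^{2h−1} ξ}` — for `g = α^j` or `α^j ξ` the count
  `#{x ∈ D : x g ∈ T₀}` equals `2 + [j = 0] − [j = h] + [u j = h] − [u j = 0] = 2` (§3 `doubleInterval_balanced`) —
  and `c` moves `1 ∈ D` to `α^h ∉ D`; so `T₀` is DEGENERATE (Hazama, gen 19/20 certificate format
  `GaloisModels.exists_simple_degenerate_of_model_balanced` with the identity model);
* of TRIVIAL LEFT STABILISER (§3 `doubleInterval_leftStabiliser`): `α^j` shifts the interval; `α^j ξ` would need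
  `j + u·[0, h) = [0, h)`, refuted by the probes `i = 0, 1, 2` (for `u = −1`, the dihedral group, the double interval IS
  stabilised — by `α^{h−1} ξ` — consistent with the dihedral classification of part IV).
Hence (§4 **`exists_simple_degenerate_of_semidihedral_or_modular`**): a Galois CM field whose Galois group is of
semidihedral or modular type of order `4h`, `h ≥ 4` even, has a SIMPLE DEGENERATE abelian variety of dimension `2h` with
an exceptional Hodge class on some power (rank `h + 1` of `2h + 1` by the seat census `scratch-g22/g22r.py` for
`4h = 16, 32, 64, 128`; gen 17: `SD₁₆`, `M₁₆`; this gen part ORDER-32: `SD₃₂`, `M₃₂` by table certificates).  With the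
cyclic, `C × C₂`, quaternion (gen 20) and dihedral (part IV) rows this completes the 2-GROUPS WITH A CYCLIC MAXIMAL
SUBGROUP: good ⟺ cyclic, `C_{2h} × C₂` with `c ∈ C_{2h}`, `Q_{4h}`, or dihedral of order `≤ 16`.

## References

* [Shimura1998] G. Shimura, *Abelian Varieties with Complex Multiplication and Modular Functions*, §6.2 Thm. 3,
  §8.2 Prop. 26, §18.2 Lemma (i).
* [Gordon1999HodgeAVSurvey] B. B. Gordon, *A survey of the Hodge conjecture for abelian varieties*, Thm. 6.4, §9.3.
* [Kubota1965] T. Kubota, Trans. AMS 118 (1965), §2.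
-/

noncomputable section

open CategoryTheory CategoryTheory.Limits NumberField
open scoped BigOperators

namespace Summit.HodgeConjecture.CorCM.GaloisSemidihedral

open Literature.NumberTheory.ComplexMultiplication
open Literature.AlgebraicGeometry.Motives (AbelianVariety CMType)
open Literature.AlgebraicGeometry.HodgeTheory
open Literature.AlgebraicGeometry.ComplexMultiplication (IsCMTypeRealisation)
open Literature.AlgebraicGeometry.Pohlmann1968
open Literature.Barriers.HodgeConjecture (divisorClassesSpan)
open Summit.HodgeConjecture.CorCM.GaloisModels
open Summit.HodgeConjecture.CorCM.CyclicAsymmetricHalves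

/-! ## §3 The double interval: CM set, balanced set, left stabiliser -/

section DoubleInterval

variable {G : Type*} [Group G] [Fintype G] [DecidableEq G] {α ξ : G} {h u₀ : ℕ}
variable {T : Finset G}

/-- **The double interval exists**: `α^x ∈ T ↔ x.val < h`, `α^x ξ ∈ T ↔ x.val < h`. [folklore] -/
theorem exists_doubleInterval [NeZero h] (hord : orderOf α = 2 * h) (hξ : ξ ∉ Subgroup.zpowers α) :
    ∃ T : Finset G, (∀ x : ZMod (2 * h), α ^ x.val ∈ T ↔ x.val < h) ∧
      (∀ x : ZMod (2 * h), α ^ x.val * ξ ∈ T ↔ x.val < h) := by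
  refine ⟨Finset.univ.filter fun g => ∃ x : ZMod (2 * h), x.val < h ∧ (g = α ^ x.val ∨ g = α ^ x.val * ξ),
    fun x => ?_, fun x => ?_⟩
  · simp only [Finset.mem_filter, Finset.mem_univ, true_and]
    constructor
    · rintro ⟨y, hy, (h1 | h1)⟩
      · rwa [(pow_val_inj hord).1 h1]
      · exact absurd h1 (pow_val_ne_pow_val_mul hξ x y)
    · exact fun hx => ⟨x, hx, Or.inl rfl⟩
  · simp only [Finset.mem_filter, Finset.mem_univ, true_and]
    constructor
    · rintro ⟨y, hy, (h1 | h1)⟩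
      · exact absurd h1.symm (pow_val_ne_pow_val_mul hξ y x)
      · rwa [(pow_val_inj hord).1 (mul_right_cancel h1)]
    · exact fun hx => ⟨x, hx, Or.inr rfl⟩

omit [DecidableEq G] in
/-- **CM set for `c = α^h`.** [cite: Shimura1998, §18.2 Lemma (i)] -/
theorem doubleInterval_cm [NeZero h] (h1 : 1 ≤ h) (hord : orderOf α = 2 * h) (hξ : ξ ∉ Subgroup.zpowers α)
    (hcard : Fintype.card G = 4 * h) (hTr : ∀ x : ZMod (2 * h), α ^ x.val ∈ T ↔ x.val < h)
    (hTx : ∀ x : ZMod (2 * h), α ^ x.val * ξ ∈ T ↔ x.val < h) (g : G) :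
    g ∈ T ↔ α ^ h * g ∉ T := by
  haveI : NeZero (2 * h) := ⟨by omega⟩
  have hαh : α ^ h = α ^ ((h : ℕ) : ZMod (2 * h)).val := by rw [val_natCast_of_lt' (show h < 2 * h by omega)]
  obtain ⟨x, rfl | rfl⟩ := exists_normalForm hord hξ hcard g
  · rw [hαh, ← pow_val_add hord, hTr, hTr, add_comm, val_add_natCast_eq x (show h < 2 * h by omega)]
    have := x.val_lt
    split_ifs <;> omega
  · rw [hαh, rot_mul_refl hord, hTx, hTx, add_comm, val_add_natCast_eq x (show h < 2 * h by omega)]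
    have := x.val_lt
    split_ifs <;> omega

omit [DecidableEq G] in
/-- **The only central involution is `α^h`** (`h ≥ 4`): a central `α^x ξ` would force `u = 1`, and an involution
`α^x ≠ 1` has `x = h`. [cite: Shimura1998, §18.2 Lemma (i)] -/
theorem central_involution_eq_pow (h4 : 4 ≤ h) (hord : orderOf α = 2 * h) (hξ : ξ ∉ Subgroup.zpowers α)
    (hrel : ξ * α = α ^ u₀ * ξ) (hu : u₀ = h - 1 ∨ u₀ = h + 1) (hcard : Fintype.card G = 4 * h) (c : G)
    (hc1 : c * c = 1) (hc2 : c ≠ 1) (hcomm : ∀ y : G, c * y = y * c) : c = α ^ h := by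
  haveI : NeZero h := ⟨by omega⟩
  haveI : NeZero (2 * h) := ⟨by omega⟩
  obtain ⟨x, rfl | rfl⟩ := exists_normalForm hord hξ hcard c
  · -- `α^x` with `x + x = 0`, `x ≠ 0`
    have hxx : x + x = 0 := by
      have h1 : α ^ (x + x).val = α ^ (0 : ZMod (2 * h)).val := by
        rw [pow_val_add hord, hc1, ZMod.val_zero, pow_zero]
      exact (pow_val_inj hord).1 h1
    have hx0 : x.val ≠ 0 := fun h0 => hc2 (by rw [h0, pow_zero])
    have hlt := x.val_lt
    have hcast : ((x.val + x.val : ℕ) : ZMod (2 * h)) = 0 := by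
      rw [Nat.cast_add, ZMod.natCast_zmod_val, hxx]
    rw [ZMod.natCast_eq_zero_iff] at hcast
    obtain ⟨q, hq⟩ := hcast
    have hq1 : q = 1 := by
      rcases Nat.lt_or_ge q 2 with hq2 | hq2
      · interval_cases q <;> omega
      · nlinarith
    rw [hq1, mul_one] at hq
    rw [show x.val = h by omega]
  · -- `α^x ξ` is not central
    exfalso
    have h1 := hcomm (α ^ ((1 : ℕ) : ZMod (2 * h)).val)
    rw [refl_mul_rot hord hrel, rot_mul_refl hord] at h1
    have h2 := (pow_val_inj hord).1 (mul_right_cancel h1)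
    rw [Nat.cast_one, mul_one, add_comm] at h2
    have h3 : (u₀ : ZMod (2 * h)) = 1 := add_right_cancel h2
    haveI : Fact (1 < 2 * h) := ⟨by omega⟩
    have h4' := congrArg ZMod.val h3
    rw [ZMod.val_natCast, ZMod.val_one] at h4'
    rcases hu with rfl | rfl
    · rw [Nat.mod_eq_of_lt (show h - 1 < 2 * h by omega)] at h4'; omega
    · rw [Nat.mod_eq_of_lt (show h + 1 < 2 * h by omega)] at h4'; omega

/-- **TRIVIAL LEFT STABILISER** of the double interval (`u₀ = h ∓ 1`, `h ≥ 4`; probes `α⁰, α¹, α²`).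
[cite: Shimura1998, §8.2 Prop. 26] -/
theorem doubleInterval_leftStabiliser (h4 : 4 ≤ h) (hord : orderOf α = 2 * h) (hξ : ξ ∉ Subgroup.zpowers α)
    (hrel : ξ * α = α ^ u₀ * ξ) (hu : u₀ = h - 1 ∨ u₀ = h + 1) (hcard : Fintype.card G = 4 * h)
    (hTr : ∀ x : ZMod (2 * h), α ^ x.val ∈ T ↔ x.val < h)
    (hTx : ∀ x : ZMod (2 * h), α ^ x.val * ξ ∈ T ↔ x.val < h) (v : G) (hv : v ≠ 1) :
    ∃ w : G, ¬ (w ∈ T ↔ v * w ∈ T) := by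
  haveI : NeZero h := ⟨by omega⟩
  haveI : NeZero (2 * h) := ⟨by omega⟩
  have cast : ∀ c : ℕ, c < 2 * h → α ^ c = α ^ ((c : ℕ) : ZMod (2 * h)).val := fun c hc => by
    rw [val_natCast_of_lt' hc]
  obtain ⟨j, rfl | rfl⟩ := exists_normalForm hord hξ hcard v
  · -- `v = α^j`, `j ≠ 0`
    have hj : j.val ≠ 0 := fun h0 => hv (by rw [h0, pow_zero])
    have hjlt := j.val_lt
    by_cases hjh : j.val < h
    · refine ⟨α ^ ((((h : ℕ) : ZMod (2 * h)) - j)).val, fun hiff => ?_⟩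
      rw [← pow_val_add hord, add_sub_cancel, hTr, hTr, val_natCast_sub_eq j (show h < 2 * h by omega),
        val_natCast_of_lt' (show h < 2 * h by omega)] at hiff
      split_ifs at hiff <;> omega
    · refine ⟨α ^ ((0 : ZMod (2 * h))).val, fun hiff => ?_⟩
      rw [← pow_val_add hord, add_zero, hTr, hTr, ZMod.val_zero] at hiff
      omega
  · -- `v = α^j ξ`: probes `α⁰, α¹, α²`
    have hjlt := j.val_lt
    have P : ∀ c : ℕ, c < 2 * h → ((α ^ ((c : ℕ) : ZMod (2 * h)).val ∈ T ↔
        (α ^ j.val * ξ) * α ^ ((c : ℕ) : ZMod (2 * h)).val ∈ T) →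
        (c < h ↔ (j + (u₀ : ZMod (2 * h)) * c).val < h)) := fun c hc hiff => by
      rwa [refl_mul_rot hord hrel, hTr, hTx, val_natCast_of_lt' hc] at hiff
    by_contra hall
    push Not at hall
    have h0 := P 0 (by omega) (hall _)
    have h1 := P 1 (by omega) (hall _)
    have h2 := P 2 (by omega) (hall _)
    rw [Nat.cast_zero, mul_zero, add_zero] at h0
    rcases hu with rfl | rfl
    · have e1 : (j + ((h - 1 : ℕ) : ZMod (2 * h)) * ((1 : ℕ) : ZMod (2 * h))) = j + ((h - 1 : ℕ) : ZMod (2 * h)) := by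
        rw [Nat.cast_one, mul_one]
      have e2 : (j + ((h - 1 : ℕ) : ZMod (2 * h)) * ((2 : ℕ) : ZMod (2 * h))) = j - ((2 : ℕ) : ZMod (2 * h)) := by
        have h2h : ((2 * h : ℕ) : ZMod (2 * h)) = 0 := ZMod.natCast_self _
        have h2h'' : ((2 : ℕ) : ZMod (2 * h)) * ((h : ℕ) : ZMod (2 * h)) = 0 := by exact_mod_cast h2h
        have h2h' : ((h : ℕ) : ZMod (2 * h)) * ((2 : ℕ) : ZMod (2 * h)) = 0 :=
          (mul_comm ((h : ℕ) : ZMod (2 * h)) ((2 : ℕ) : ZMod (2 * h))).trans h2h''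
        have hm : ((h - 1 : ℕ) : ZMod (2 * h)) * ((2 : ℕ) : ZMod (2 * h)) = -((2 : ℕ) : ZMod (2 * h)) := by
          rw [Nat.cast_sub (by omega : 1 ≤ h), Nat.cast_one, sub_mul, one_mul, h2h', zero_sub]
        rw [hm, sub_eq_add_neg]
      rw [e1, val_add_natCast_eq j (show h - 1 < 2 * h by omega)] at h1
      rw [e2, val_sub_natCast_eq j (show 2 < 2 * h by omega)] at h2
      split_ifs at h1 h2 <;> omega
    · have e1 : (j + ((h + 1 : ℕ) : ZMod (2 * h)) * ((1 : ℕ) : ZMod (2 * h))) = j + ((h + 1 : ℕ) : ZMod (2 * h)) := by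
        rw [Nat.cast_one, mul_one]
      have e2 : (j + ((h + 1 : ℕ) : ZMod (2 * h)) * ((2 : ℕ) : ZMod (2 * h))) = j + ((2 : ℕ) : ZMod (2 * h)) := by
        have h2h : ((2 * h : ℕ) : ZMod (2 * h)) = 0 := ZMod.natCast_self _
        have h2h'' : ((2 : ℕ) : ZMod (2 * h)) * ((h : ℕ) : ZMod (2 * h)) = 0 := by exact_mod_cast h2h
        have h2h' : ((h : ℕ) : ZMod (2 * h)) * ((2 : ℕ) : ZMod (2 * h)) = 0 :=
          (mul_comm ((h : ℕ) : ZMod (2 * h)) ((2 : ℕ) : ZMod (2 * h))).trans h2h''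
        have hm : ((h + 1 : ℕ) : ZMod (2 * h)) * ((2 : ℕ) : ZMod (2 * h)) = ((2 : ℕ) : ZMod (2 * h)) := by
          rw [Nat.cast_add, Nat.cast_one, add_mul, one_mul, h2h', zero_add]
        rw [hm]
      rw [e1, val_add_natCast_eq j (show h + 1 < 2 * h by omega)] at h1
      rw [e2, val_add_natCast_eq j (show 2 < 2 * h by omega)] at h2
      split_ifs at h1 h2 <;> omega

omit [Fintype G] [DecidableEq G] in
/-- The four elements `1, α^{h−1}, α^h ξ, α^{2h−1} ξ` are pairwise distinct (the facts needed below). [folklore] -/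
theorem doubleInterval_D_distinct (h4 : 4 ≤ h) (hord : orderOf α = 2 * h) (hξ : ξ ∉ Subgroup.zpowers α) :
    (1 : G) ≠ α ^ ((h - 1 : ℕ) : ZMod (2 * h)).val ∧ (1 : G) ≠ α ^ ((h : ℕ) : ZMod (2 * h)).val * ξ ∧
      (1 : G) ≠ α ^ ((2 * h - 1 : ℕ) : ZMod (2 * h)).val * ξ ∧
      α ^ ((h - 1 : ℕ) : ZMod (2 * h)).val ≠ α ^ ((h : ℕ) : ZMod (2 * h)).val * ξ ∧
      α ^ ((h - 1 : ℕ) : ZMod (2 * h)).val ≠ α ^ ((2 * h - 1 : ℕ) : ZMod (2 * h)).val * ξ ∧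
      α ^ ((h : ℕ) : ZMod (2 * h)).val * ξ ≠ α ^ ((2 * h - 1 : ℕ) : ZMod (2 * h)).val * ξ := by
  haveI : NeZero h := ⟨by omega⟩
  haveI : NeZero (2 * h) := ⟨by omega⟩
  have e0 : (1 : G) = α ^ (0 : ZMod (2 * h)).val := by rw [ZMod.val_zero, pow_zero]
  refine ⟨fun heq => ?_, ?_, ?_, pow_val_ne_pow_val_mul hξ _ _, pow_val_ne_pow_val_mul hξ _ _, fun heq => ?_⟩
  · rw [e0] at heq
    have := congrArg ZMod.val ((pow_val_inj hord).1 heq)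
    rw [ZMod.val_zero, val_natCast_of_lt' (show h - 1 < 2 * h by omega)] at this
    omega
  · rw [e0]; exact pow_val_ne_pow_val_mul hξ _ _
  · rw [e0]; exact pow_val_ne_pow_val_mul hξ _ _
  · have := congrArg ZMod.val ((pow_val_inj hord).1 (mul_right_cancel heq))
    rw [val_natCast_of_lt' (show h < 2 * h by omega), val_natCast_of_lt' (show 2 * h - 1 < 2 * h by omega)] at this
    omega

/-- **THE BALANCED SET `D = {1, α^{h−1}, α^h ξ, α^{2h−1} ξ}`**: `2 · #{x ∈ D : x g ∈ T} = 4 = #D` for every `g`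
(the count is `2 + [j = 0] − [j = h] + [u j = h] − [u j = 0]`). [cite: Gordon1999HodgeAVSurvey, §9.3] -/
theorem doubleInterval_balanced (h4 : 4 ≤ h) (heven : Even h) (hord : orderOf α = 2 * h)
    (hξ : ξ ∉ Subgroup.zpowers α) (hrel : ξ * α = α ^ u₀ * ξ) (hξ2 : ξ * ξ = 1) (hu : u₀ = h - 1 ∨ u₀ = h + 1)
    (hcard : Fintype.card G = 4 * h) (hTr : ∀ x : ZMod (2 * h), α ^ x.val ∈ T ↔ x.val < h)
    (hTx : ∀ x : ZMod (2 * h), α ^ x.val * ξ ∈ T ↔ x.val < h) (g : G) :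
    2 * (({(1 : G), α ^ ((h - 1 : ℕ) : ZMod (2 * h)).val,
        α ^ ((h : ℕ) : ZMod (2 * h)).val * ξ, α ^ ((2 * h - 1 : ℕ) : ZMod (2 * h)).val * ξ} : Finset G).filter
        fun x => x * g ∈ T).card = 4 := by
  haveI : NeZero h := ⟨by omega⟩
  haveI : NeZero (2 * h) := ⟨by omega⟩
  obtain ⟨hne12, hne13, hne14, hne23, hne24, hne34⟩ := doubleInterval_D_distinct h4 hord hξ
  have hz := fun j => (mul_eq_zero_iff_and_mul_eq_h_iff heven (by omega) hu j).1
  have hh := fun j => (mul_eq_zero_iff_and_mul_eq_h_iff heven (by omega) hu j).2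
  have e : ∀ z : ZMod (2 * h), z.val = h ↔ z = ((h : ℕ) : ZMod (2 * h)) := fun z => by
    constructor
    · intro hzv; apply ZMod.val_injective; rw [hzv, val_natCast_of_lt' (show h < 2 * h by omega)]
    · intro hzv; rw [hzv, val_natCast_of_lt' (show h < 2 * h by omega)]
  have hn1 : (1 : G) ∉ ({α ^ ((h - 1 : ℕ) : ZMod (2 * h)).val, α ^ ((h : ℕ) : ZMod (2 * h)).val * ξ,
      α ^ ((2 * h - 1 : ℕ) : ZMod (2 * h)).val * ξ} : Finset G) := by
    simp only [Finset.mem_insert, Finset.mem_singleton, not_or]; exact ⟨hne12, hne13, hne14⟩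
  have hn2 : α ^ ((h - 1 : ℕ) : ZMod (2 * h)).val ∉ ({α ^ ((h : ℕ) : ZMod (2 * h)).val * ξ,
      α ^ ((2 * h - 1 : ℕ) : ZMod (2 * h)).val * ξ} : Finset G) := by
    simp only [Finset.mem_insert, Finset.mem_singleton, not_or]; exact ⟨hne23, hne24⟩
  have hn3 : α ^ ((h : ℕ) : ZMod (2 * h)).val * ξ ∉ ({α ^ ((2 * h - 1 : ℕ) : ZMod (2 * h)).val * ξ} : Finset G) := by
    simp only [Finset.mem_singleton]; exact hne34
  rw [Finset.card_filter, Finset.sum_insert hn1, Finset.sum_insert hn2, Finset.sum_insert hn3, Finset.sum_singleton]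
  obtain ⟨j, rfl | rfl⟩ := exists_normalForm hord hξ hcard g
  · have m1 : (1 : G) * α ^ j.val ∈ T ↔ j.val < h := by rw [one_mul, hTr]
    have m2 : α ^ ((h - 1 : ℕ) : ZMod (2 * h)).val * α ^ j.val ∈ T ↔ (j.val = 0 ∨ h + 1 ≤ j.val) := by
      rw [← pow_val_add hord, hTr, add_comm, val_add_natCast_eq j (show h - 1 < 2 * h by omega)]
      have := j.val_lt
      split_ifs <;> omega
    have m3 : α ^ ((h : ℕ) : ZMod (2 * h)).val * ξ * α ^ j.val ∈ T ↔ h ≤ ((u₀ : ZMod (2 * h)) * j).val := by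
      rw [refl_mul_rot hord hrel, hTx, add_comm, val_add_natCast_eq _ (show h < 2 * h by omega)]
      have := ((u₀ : ZMod (2 * h)) * j).val_lt
      split_ifs <;> omega
    have m4 : α ^ ((2 * h - 1 : ℕ) : ZMod (2 * h)).val * ξ * α ^ j.val ∈ T ↔
        (1 ≤ ((u₀ : ZMod (2 * h)) * j).val ∧ ((u₀ : ZMod (2 * h)) * j).val ≤ h) := by
      rw [refl_mul_rot hord hrel, hTx, add_comm, val_add_natCast_eq _ (show 2 * h - 1 < 2 * h by omega)]
      have := ((u₀ : ZMod (2 * h)) * j).val_lt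
      split_ifs <;> omega
    have k0 : ((u₀ : ZMod (2 * h)) * j).val = 0 ↔ j.val = 0 := by
      rw [ZMod.val_eq_zero, ZMod.val_eq_zero]; exact hz j
    have kh : ((u₀ : ZMod (2 * h)) * j).val = h ↔ j.val = h := by rw [e, e]; exact hh j
    have hj := j.val_lt
    have hb := ((u₀ : ZMod (2 * h)) * j).val_lt
    simp only [m1, m2, m3, m4]
    split_ifs <;> omega
  · have m1 : (1 : G) * (α ^ j.val * ξ) ∈ T ↔ j.val < h := by rw [one_mul, hTx]
    have m2 : α ^ ((h - 1 : ℕ) : ZMod (2 * h)).val * (α ^ j.val * ξ) ∈ T ↔ (j.val = 0 ∨ h + 1 ≤ j.val) := by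
      rw [rot_mul_refl hord, hTx, add_comm, val_add_natCast_eq j (show h - 1 < 2 * h by omega)]
      have := j.val_lt
      split_ifs <;> omega
    have m3 : α ^ ((h : ℕ) : ZMod (2 * h)).val * ξ * (α ^ j.val * ξ) ∈ T ↔ h ≤ ((u₀ : ZMod (2 * h)) * j).val := by
      rw [refl_mul_refl hord hrel hξ2, hTr, add_comm, val_add_natCast_eq _ (show h < 2 * h by omega)]
      have := ((u₀ : ZMod (2 * h)) * j).val_lt
      split_ifs <;> omega
    have m4 : α ^ ((2 * h - 1 : ℕ) : ZMod (2 * h)).val * ξ * (α ^ j.val * ξ) ∈ T ↔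
        (1 ≤ ((u₀ : ZMod (2 * h)) * j).val ∧ ((u₀ : ZMod (2 * h)) * j).val ≤ h) := by
      rw [refl_mul_refl hord hrel hξ2, hTr, add_comm, val_add_natCast_eq _ (show 2 * h - 1 < 2 * h by omega)]
      have := ((u₀ : ZMod (2 * h)) * j).val_lt
      split_ifs <;> omega
    have k0 : ((u₀ : ZMod (2 * h)) * j).val = 0 ↔ j.val = 0 := by
      rw [ZMod.val_eq_zero, ZMod.val_eq_zero]; exact hz j
    have kh : ((u₀ : ZMod (2 * h)) * j).val = h ↔ j.val = h := by rw [e, e]; exact hh j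
    have hj := j.val_lt
    have hb := ((u₀ : ZMod (2 * h)) * j).val_lt
    simp only [m1, m2, m3, m4]
    split_ifs <;> omega

end DoubleInterval

/-! ## §4 Field level -/

section Field

variable {K : Type} [Field K] [NumberField K] [IsCMField K] [IsGalois ℚ K]

/-- **THEOREM.  Galois CM field with Galois group of SEMIDIHEDRAL or MODULAR type of order `4h`, `h ≥ 4` even**
(`α` of order `2h`, an involution `ξ ∉ ⟨α⟩` with `ξ α = α^{h−1} ξ` resp. `ξ α = α^{h+1} ξ`, `[K:ℚ] = 4h`; complex
conjugation is then `α^h`): a SIMPLE DEGENERATE abelian variety of dimension `2h` with CM by `K` exists, with an exceptional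
Hodge class on some power — the double interval `{αⁱ, αⁱξ : i < h}` is a primitive degenerate CM type.
[cite: Shimura1998, §6.2 Thm. 3 and §8.2 Prop. 26] [cite: Gordon1999HodgeAVSurvey, Thm. 6.4 and §9.3] [cite: Kubota1965, §2] -/
theorem exists_simple_degenerate_of_semidihedral_or_modular {h u₀ : ℕ} (h4 : 4 ≤ h) (heven : Even h)
    (α ξ : K ≃ₐ[ℚ] K) (hord : orderOf α = 2 * h) (hξ : ξ ∉ Subgroup.zpowers α) (hξ2 : ξ * ξ = 1)
    (hrel : ξ * α = α ^ u₀ * ξ) (hu : u₀ = h - 1 ∨ u₀ = h + 1) (hK : Module.finrank ℚ K = 4 * h) :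
    ∃ (Φ : CMType K) (φ₀ : K →+* ℂ) (A : AbelianVariety ℂ) (ι : 𝓞 K →+* End A)
      (θ : K →+* Module.End ℂ (complexBetti A.X 1)),
      IsPrimitive (ℂ ≃+* ℂ) Φ.1 φ₀ ∧ ¬ IsNondegenerate Φ ∧ IsCMTypeRealisation Φ A ι θ ∧ A.IsSimple ∧
      A.dim = 2 * h ∧
      ∃ n p : ℕ, ∃ x : complexBetti (⨁ fun _ : Fin n => A).X (2 * p), IsRationalClass x ∧
        IsOfHodgeType (⨁ fun _ : Fin n => A).dim (⨁ fun _ : Fin n => A).X (2 * p) p p x ∧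
        x ∉ divisorClassesSpan (⨁ fun _ : Fin n => A).X (⨁ fun _ : Fin n => A).dim p := by
  classical
  haveI : NeZero h := ⟨by omega⟩
  haveI : NeZero (2 * h) := ⟨by omega⟩
  have hcard : Fintype.card (K ≃ₐ[ℚ] K) = 4 * h := by
    rw [← hK, ← IsGalois.card_aut_eq_finrank, Nat.card_eq_fintype_card]
  have hc : (IsCMField.complexConj K).restrictScalars ℚ = α ^ h :=
    central_involution_eq_pow (G := K ≃ₐ[ℚ] K) h4 hord hξ hrel hu hcard _
      (GaloisRank.model_complexConj_mul_self (MulEquiv.refl _) rfl)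
      (GaloisRank.model_complexConj_ne_one (MulEquiv.refl _) rfl)
      (GaloisRank.model_complexConj_comm (MulEquiv.refl _) rfl)
  obtain ⟨T, hTr, hTx⟩ := exists_doubleInterval (G := K ≃ₐ[ℚ] K) hord hξ
  have hαh : α ^ h = α ^ ((h : ℕ) : ZMod (2 * h)).val := by rw [val_natCast_of_lt' (show h < 2 * h by omega)]
  obtain ⟨hne12, hne13, hne14, hne23, hne24, hne34⟩ := doubleInterval_D_distinct (G := K ≃ₐ[ℚ] K) h4 hord hξ
  have hmain := exists_simple_degenerate_of_model_balanced (MulEquiv.refl (K ≃ₐ[ℚ] K)) (α ^ h)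
    (by rw [MulEquiv.refl_apply, hc]) T
    (fun x => doubleInterval_cm (by omega) hord hξ hcard hTr hTx x)
    (doubleInterval_leftStabiliser h4 hord hξ hrel hu hcard hTr hTx)
    {(1 : K ≃ₐ[ℚ] K), α ^ ((h - 1 : ℕ) : ZMod (2 * h)).val,
      α ^ ((h : ℕ) : ZMod (2 * h)).val * ξ, α ^ ((2 * h - 1 : ℕ) : ZMod (2 * h)).val * ξ}
    (fun g => by
      have hn1 : (1 : K ≃ₐ[ℚ] K) ∉ ({α ^ ((h - 1 : ℕ) : ZMod (2 * h)).val, α ^ ((h : ℕ) : ZMod (2 * h)).val * ξ,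
          α ^ ((2 * h - 1 : ℕ) : ZMod (2 * h)).val * ξ} : Finset (K ≃ₐ[ℚ] K)) := by
        simp only [Finset.mem_insert, Finset.mem_singleton, not_or]; exact ⟨hne12, hne13, hne14⟩
      have hn2 : α ^ ((h - 1 : ℕ) : ZMod (2 * h)).val ∉ ({α ^ ((h : ℕ) : ZMod (2 * h)).val * ξ,
          α ^ ((2 * h - 1 : ℕ) : ZMod (2 * h)).val * ξ} : Finset (K ≃ₐ[ℚ] K)) := by
        simp only [Finset.mem_insert, Finset.mem_singleton, not_or]; exact ⟨hne23, hne24⟩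
      have hn3 : α ^ ((h : ℕ) : ZMod (2 * h)).val * ξ ∉
          ({α ^ ((2 * h - 1 : ℕ) : ZMod (2 * h)).val * ξ} : Finset (K ≃ₐ[ℚ] K)) := by
        simp only [Finset.mem_singleton]; exact hne34
      rw [doubleInterval_balanced h4 heven hord hξ hrel hξ2 hu hcard hTr hTx g, Finset.card_insert_of_notMem hn1,
        Finset.card_insert_of_notMem hn2, Finset.card_insert_of_notMem hn3, Finset.card_singleton])
    ⟨1, by simp, by
      rw [mul_one, hαh]
      simp only [Finset.mem_insert, Finset.mem_singleton, not_or]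
      refine ⟨fun heq => ?_, fun heq => ?_, pow_val_ne_pow_val_mul hξ _ _, pow_val_ne_pow_val_mul hξ _ _⟩
      · have e0 : (1 : K ≃ₐ[ℚ] K) = α ^ (0 : ZMod (2 * h)).val := by rw [ZMod.val_zero, pow_zero]
        rw [e0] at heq
        have := congrArg ZMod.val ((pow_val_inj hord).1 heq)
        rw [val_natCast_of_lt' (show h < 2 * h by omega), ZMod.val_zero] at this
        omega
      · have := congrArg ZMod.val ((pow_val_inj hord).1 heq)
        rw [val_natCast_of_lt' (show h < 2 * h by omega), val_natCast_of_lt' (show h - 1 < 2 * h by omega)] at this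
        omega⟩
  rwa [hcard, show 4 * h / 2 = 2 * h by omega] at hmain

end Field

end Summit.HodgeConjecture.CorCM.GaloisSemidihedral

end
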